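import Summits.BirchSwinnertonDyer.BirchSwinnertonDyer.Theorems.PrintCFramBottomClassIndexLawFiveLeHeegnerFieldSupplySeedOn
import HarnessLib

/-!
# Crux `PrintCFram.BottomClassIndexLawFiveLe` (stmt-BirchSwinnertonDyer-20372), line `eisenstein-resource-bdp-line` (registry v20/v21):
# A SEED FROM A REGULAR REAL-TWIST PARTNER — `(Seed⁶)(e)` holds as soon as ONE member `e·s` of the class's real-twist progression
# (`s > 0` squarefree, `s ≡ 1 (4)`, `(s/q) = (−p/q)` at the primes of `m`) is Eisenstein-REGULAR
# (cell `bsd-print-cfram`, width seat `bsd-line-cfram-p1-w8` g5; THEOREMS ONLY, `--supports` 20372; BSD is not proved by any of this)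

HONEST FRAMING. Nothing here is a statement about BSD; Stub C is not proved. After LEAD g12's at-`p` rung (`…HeegnerFieldSupplyAtPRung`,
p681058: `(P⁶) ⟸ (AtP⁶) ∧ (Seed⁶)`; θ-cycle proof of (AtP⁶) in the LEAD's crux notes §3.4, checked by this seat) and this seat's
`seedOn_six` (p681991: `(Seed⁶)` ON the locus `L(m,p)`, the seed being the CM field `ℚ(√−p)`), the analytic residue of the line is
`(SeedII⁶)`: OFF the locus, SOME imaginary quadratic `K₀` with every prime of `m` split (no condition at `p`) and unit field factor.
This file proves a SUFFICIENT CONDITION for `(Seed⁶)(e)` in the currency of the line's own B1-dichotomy (Eisenstein-regular vs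
-irregular members): take `K₀ := ℚ(√(−p·s))` for a squarefree `s > 0`, `s ≡ 1 (mod 4)`, `s ⊥ p·m`, with `J(−ps | q) = 1` at every odd
prime `q ∣ m` (and `−ps ≡ 1 (mod 8)` if `2 ∣ m`) — then every prime of `m` splits in `K₀`, `d_{K₀} = −ps` is odd `< −4`, its Kronecker
character is `J(· | ps) = (·/p)·J(· | s)`, and by the CM reflection of `…HeegnerFieldSupplyReflection` (p680812, applied to the character
`χ·χ_s` of conductor `m·s ⊥ p`):

  field factor of `e` at `K₀`  `= ‖k⁻¹ B_{k,(χ χ_s)·(·/p)}‖_p`  is a unit  ⟺  `‖(p−k)⁻¹ B_{p−k, χ χ_s}‖_p` is a unit  ⟺  the member `e·s` is REGULAR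

(`seed_six_of_regularPartner`; `s = 1` is `seedOn_six`). READING: `(SeedII⁶)(e) ⟸` «the real-twist progression of `e` cut out by
`(s/q) = (−p/q)` (`q ∣ m`), `s ≡ 1 (4)`, contains a member `e·s` whose class factor is a unit» — i.e. the B1-type (Eisenstein-irregular)
members do not FILL that progression. Irregular members are sparse (2 of 65 on the window; heuristically density `1/p`), so this is
morally certain for every class, but as a uniform statement it is again a horizontal non-vanishing mod `p` (of `H(p−k, m·s)` over real
`s` with conditions at `q ∣ 2·3·m`, none at `p`) and is NOT claimed. In Cohen–Eisenstein terms this is the coefficient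
`H(k, m·p·s) ≡ H(p−k, m·s) (mod p)` of the cut form `G_e` at a `K₀`-RAMIFIED index (LEAD notes §3.2). beyond-print theorem: NO.

References: [Washington1997] Thm. 5.11, Cor. 5.13; [Cox2013] §1.C Lemma 1.14; [Marcus2018] Ch. 2 Thm. 1, Ch. 3 Thm. 25; [KrizLi2019] Thm. 1.20, §8;
crux notes `Lines/eisenstein-resource-bdp-line-w8g5-notes.md` §4, `…-lead-g12.md` §3.2/§3.5.
-/

set_option autoImplicit false
-- summit-side namespace `Summit.BirchSwinnertonDyer.BirchSwinnertonDyer.…` (single-conjunct summit, D-0017 layout)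
set_option linter.dupNamespace false

noncomputable section

open scoped Classical NumberTheorySymbols
open NumberField WeierstrassCurve DirichletCharacter Literature.NumberTheory.LFunctions
  Literature.NumberTheory.EllipticCurves Literature.NumberTheory.EllipticCurves.KrizLi2019
  Literature.NumberTheory.EllipticCurves.Rank1Residual Literature.NumberTheory.Congruences
  Literature.NumberTheory.QuadraticFields

namespace Summit.BirchSwinnertonDyer.BirchSwinnertonDyer.Theorems.PrintCFram.HeegnerFieldSupply

open Summit.BirchSwinnertonDyer.BirchSwinnertonDyer.Theorems.PrintCFram
open Summit.BirchSwinnertonDyer.BirchSwinnertonDyer.Theorems.PrintCFram.KummerDictionary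
open Summit.BirchSwinnertonDyer.Rank1Residual Summit.BirchSwinnertonDyer.Rank1Residual.X12.O11

variable {p : ℕ} [hp : Fact p.Prime]

/-! ## §1 The product character `χ↑·χ_s↑` is primitive of conductor `m·s` -/

/-- **`χ↑·χ_s↑` (level `m·s`) is primitive** for `χ` primitive mod `m`, `χ_s = J(· | s)` mod `s` with `s` odd squarefree and `m ⊥ s`
(coprime conductors multiply). [cite: Washington1997, Ch. 3 (conductors)] [cite: Cox2013, §1.C Lemma 1.14] -/
theorem mul_jacobiChar_isPrimitive {m s : ℕ} [NeZero m] [NeZero s] (χ : DirichletCharacter ℚ_[p] m) (hχ : χ.IsPrimitive)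
    {χs : DirichletCharacter ℚ_[p] s} (hχs : ∀ a : ℕ, χs (a : ZMod s) = (J((a : ℤ) | s) : ℚ_[p]))
    (hsodd : Odd s) (hsq : Squarefree s) (hms : m.Coprime s) :
    (changeLevel (dvd_mul_right m s) χ * changeLevel (dvd_mul_left s m) χs : DirichletCharacter ℚ_[p] (m * s)).IsPrimitive := by
  have hcχ : χ.conductor = m := hχ
  have hcs : χs.conductor = s := KrizLiBinders.isPrimitive_of_forall_eq_jacobiSym hχs hsodd hsq
  rw [isPrimitive_def, RouteU.conductor_changeLevel_mul_changeLevel _ _ χ χs (by rw [hcχ, hcs]; exact hms), hcχ, hcs]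

/-! ## §2 `(Seed⁶)(e)` from a regular real-twist partner -/

/-- **A SEED FROM A REGULAR REAL-TWIST PARTNER.** Binders of `(Seed⁶)` (`p ∈ {7,11,19,43,67,163}`, `m ⊥ p`, `χ` primitive quadratic mod `m`,
`k ∈ {(p+1)/4, (3p−1)/4}`); data: `s` squarefree with `s ≡ 1 (mod 4)`, `s ⊥ p`, `s ⊥ m`, a `ℚ_p`-valued character `χ_s` mod `s` with values
`J(· | s)`, the splitting clauses `J(−ps | q) = 1` for odd primes `q ∣ m` and `−ps ≡ 1 (mod 8)` if `2 ∣ m`, and REGULARITY OF THE PARTNER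
`e·s`: `¬ ‖(p−k)⁻¹ B_{p−k, χ↑χ_s↑}‖ ≤ p⁻¹`. Conclusion: the `∃ K₀` clause of `(Seed⁶)` VERBATIM (every prime of `m` split in `K₀`, `d_{K₀}` odd
`< −4`, Kronecker `ε₀`, unit field factor `‖k⁻¹ B_{k,(χ↑ε₀↑)~}‖`), with `K₀ = ℚ(√(−ps))`. `s = 1` is `seedOn_six`.
[cite: Washington1997, Thm. 5.11 and Cor. 5.13] [cite: Marcus2018, Ch. 3 Thm. 25] [cite: Cox2013, §1.C Lemma 1.14] -/
theorem seed_six_of_regularPartner (hp6 : p = 7 ∨ p = 11 ∨ p = 19 ∨ p = 43 ∨ p = 67 ∨ p = 163)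
    {m : ℕ} [hm : NeZero m] (χ : DirichletCharacter ℚ_[p] m) {k : ℕ} (hmp : m.Coprime p) (hχ : χ.IsPrimitive)
    (hk : k = (p + 1) / 4 ∨ k = (3 * p - 1) / 4)
    {s : ℕ} [NeZero s] (hsq : Squarefree s) (hs4 : s % 4 = 1) (hsp : s.Coprime p) (hms : m.Coprime s)
    {χs : DirichletCharacter ℚ_[p] s} (hχs : ∀ a : ℕ, χs (a : ZMod s) = (J((a : ℤ) | s) : ℚ_[p]))
    (hLq : ∀ q : ℕ, q.Prime → q ∣ m → q ≠ 2 → jacobiSym (-((p * s : ℕ) : ℤ)) q = 1)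
    (hL2 : 2 ∣ m → (p * s) % 8 = 7)
    (hreg : ¬ ‖((p - k : ℕ) : ℚ_[p])⁻¹ * generalizedBernoulli (p - k)
      (changeLevel (dvd_mul_right m s) χ * changeLevel (dvd_mul_left s m) χs)‖ ≤ (p : ℝ)⁻¹) :
    ∃ (K₀ : Type) (_ : Field K₀) (_ : NumberField K₀) (ε₀ : DirichletCharacter ℚ_[p] (NumberField.discr K₀).natAbs),
      IsImaginaryQuadratic K₀ ∧
      (∀ q : ℕ, q.Prime → q ∣ m → ((Ideal.span {(q : ℤ)}).primesOver (𝓞 K₀)).ncard = 2) ∧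
      Odd (NumberField.discr K₀) ∧ NumberField.discr K₀ < -4 ∧ IsKroneckerCharacterOf K₀ ε₀ ∧
      ¬ ‖(k : ℚ_[p])⁻¹ * @generalizedBernoulli ℚ_[p] _ _
          (changeLevel (dvd_mul_right m (NumberField.discr K₀).natAbs) χ *
            changeLevel (dvd_mul_left (NumberField.discr K₀).natAbs m) ε₀).conductor ⟨conductor_ne_zero _⟩ k
          (changeLevel (dvd_mul_right m (NumberField.discr K₀).natAbs) χ *
            changeLevel (dvd_mul_left (NumberField.discr K₀).natAbs m) ε₀).primitiveCharacter‖ ≤ (p : ℝ)⁻¹ := by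
  have hpp := hp.out
  have hp3 : p % 4 = 3 := by rcases hp6 with h | h | h | h | h | h <;> subst h <;> norm_num
  have h7 : 7 ≤ p := by rcases hp6 with h | h | h | h | h | h <;> omega
  have hp2 : p ≠ 2 := by omega
  have hs0 : s ≠ 0 := hsq.ne_zero
  have hsodd : Odd s := Nat.odd_iff.mpr (by omega)
  set n : ℕ := p * s with hn
  haveI : NeZero p := ⟨hpp.ne_zero⟩
  have hn3 : n % 4 = 3 := by simp [hn, Nat.mul_mod, hp3, hs4]
  have hn7 : 7 ≤ n := by
    rw [hn]
    exact le_trans h7 (Nat.le_mul_of_pos_right p (Nat.pos_of_ne_zero hs0))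
  have hnsq : Squarefree n := by
    rw [hn, Nat.squarefree_mul hsp.symm]
    exact ⟨hpp.squarefree, hsq⟩
  -- the field `K₀ = ℚ(√(−ps))`
  have hsqZ : Squarefree (-(n : ℤ)) := by
    rw [← Int.squarefree_natAbs]
    simpa using hnsq
  obtain ⟨K₀, iF, iN, h2, hd⟩ := Quadratic.exists_numberField_discr_eq (D := -(n : ℤ))
    (Or.inl ⟨by omega, hsqZ, by omega⟩)
  have hK₀ : IsImaginaryQuadratic K₀ := isImaginaryQuadratic_of_discr_eq_of_neg h2 hd (by omega)
  have hdn : (NumberField.discr K₀).natAbs = n := by rw [hd]; simp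
  -- its Kronecker character `J(· | ps)` and a Teichmüller character
  obtain ⟨ε₀, hε₀, hε₀v⟩ :=
    KrizLiBinders.exists_isKroneckerCharacterOf_of_discr (p := p) h2 (m := n) hnsq (Or.inr ⟨hd, hn3⟩)
  obtain ⟨ω, hω⟩ := exists_isTeichmullerCharacter (p := p)
  have hh : (p - 1) / 2 ≠ 0 := by omega
  refine ⟨K₀, iF, iN, ε₀, hK₀, ?_, ?_, ?_, hε₀, ?_⟩
  · -- every prime of `m` splits in `K₀`
    intro q hq hqm
    by_cases hq2 : q = 2
    · subst hq2
      have h8 : NumberField.discr K₀ % 8 = 1 := by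
        rw [hd]
        have := hL2 hqm
        omega
      have h := (Quadratic.ncard_primesOver_two_eq_two_iff h2).mpr h8
      simpa using h
    · rw [Quadratic.ncard_primesOver_eq_two_iff_jacobiSym h2 hq hq2, hd]
      exact hLq q hq hqm hq2
  · rw [hd, Int.odd_iff]
    omega
  · rw [hd]
    omega
  · -- the field factor at `K₀` is the reflected class factor of the partner `e·s`
    set Ψ : DirichletCharacter ℚ_[p] (m * (NumberField.discr K₀).natAbs) :=
      changeLevel (dvd_mul_right m (NumberField.discr K₀).natAbs) χ *
        changeLevel (dvd_mul_left (NumberField.discr K₀).natAbs m) ε₀ with hΨ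
    set χ' : DirichletCharacter ℚ_[p] (m * s) :=
      changeLevel (dvd_mul_right m s) χ * changeLevel (dvd_mul_left s m) χs with hχ'
    have hmsp : (m * s).Coprime p := Nat.coprime_mul_iff_left.mpr ⟨hmp, hsp⟩
    have hcχ : χ.conductor = m := hχ
    have hcε : ε₀.conductor = (NumberField.discr K₀).natAbs := hε₀.1
    have hmn : m.Coprime n := by rw [hn]; exact Nat.Coprime.mul_right hmp hms
    have hcond : Ψ.conductor = m * s * p := by
      rw [hΨ, RouteU.conductor_changeLevel_mul_changeLevel _ _ χ ε₀ (by rw [hcχ, hcε, hdn]; exact hmn), hcχ, hcε, hdn, hn]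
      ring
    have hΨprim : Ψ.IsPrimitive := by
      rw [isPrimitive_def, RouteU.conductor_changeLevel_mul_changeLevel _ _ χ ε₀ (by rw [hcχ, hcε, hdn]; exact hmn), hcχ, hcε]
    have hval : ∀ a : ℕ, Ψ.primitiveCharacter (a : ZMod Ψ.conductor) =
        (changeLevel (dvd_mul_right (m * s) p) χ' * changeLevel (dvd_mul_left p (m * s)) (ω ^ ((p - 1) / 2)) :
          DirichletCharacter ℚ_[p] (m * s * p)) (a : ZMod (m * s * p)) := by
      intro a
      rw [primitiveCharacter_apply_natCast_of_isPrimitive Ψ hΨprim a, hΨ,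
        CharacterTwist.changeLevel_mul_changeLevel_apply_natCast χ ε₀ a, thetaShape_apply_natCast χ' ω hh a, hχ',
        CharacterTwist.changeLevel_mul_changeLevel_apply_natCast χ χs a, hε₀v a, hχs a, hn,
        jacobiSym.mul_right, Int.cast_mul, jacobiSym_eq_teichmuller_pow_half hω hp2 a]
      ring
    have hB : @generalizedBernoulli ℚ_[p] _ _ Ψ.conductor ⟨conductor_ne_zero _⟩ k Ψ.primitiveCharacter =
        generalizedBernoulli k (changeLevel (dvd_mul_right (m * s) p) χ' *
          changeLevel (dvd_mul_left p (m * s)) (ω ^ ((p - 1) / 2))) := by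
      haveI : NeZero Ψ.conductor := ⟨conductor_ne_zero _⟩
      exact generalizedBernoulli_eq_of_forall_apply_natCast_eq hcond _ _ hval k
    intro hle
    apply hreg
    rw [hB] at hle
    exact (norm_div_generalizedBernoulli_legendreTwist_le_inv_iff hp3 h7 hmsp χ' hω hk).mp hle

end Summit.BirchSwinnertonDyer.BirchSwinnertonDyer.Theorems.PrintCFram.HeegnerFieldSupply

end
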